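import Summits.Ventures.Crystal3D.Theorems.StickyWulffConstantCoaxialWallLawThinWallCount
import HarnessLib

/-!
# Thin-wall law, two more inputs: fibres of the foot map (separated form) and the descent-rate constant

HONEST FRAMING. Part of the venture `Summits/Ventures/Crystal3D` (cell `crystal3d-full`), helper
`--supports` the crux `CoaxialWallLaw` (stmt-Ventures-19481, `route-Ventures-StickyWulffConstant`),
REGISTERED line `WallLedgerF` (planner cf-p1 gen 16), stub `stub_coaxialTwoSlabAdhesion`.  Rung credit
only; F-C1 not moved.

* `card_le_of_foot_map_sep` — `card_le_of_foot_map` with the hypothesis «the walk point is a ball of `X`»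
  replaced by «`E` is `1`-separated» (the kissing bound is applied to `E` translated): if every `e ∈ E` is
  `y − k·A(uᵢ − uⱼ)` with `y` within contact distance one of some `z ∈ Z`, `k ≤ K`, then `#E ≤ 1872(K+1)·#Z`.
* `third_le_descent_rate` — `√(2/3) ≤ S + s` and `s ≤ 2/5` give `1/3 ≤ (√3/2)·S` (numerics `√2 ≥ 1.41`,
  `√3 ≤ 1.7321`).

WHAT THIS IS NOT: not the stub; F-C1 not moved.
-/

noncomputable section

namespace Summit.Ventures.Crystal3D.Theorems

open Summit.Ventures.Crystal3D Finset
open Literature.MathematicalPhysics.StatisticalMechanics (fccStacking)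
open scoped InnerProductSpace

open scoped Classical in
/-- **Fibres of the foot map (separated form).**  If `E` is `1`-separated and every `e ∈ E` is
`y − k·A(uᵢ − uⱼ)` with `y` within contact distance one of some `z ∈ Z`, `k ≤ K`, `uᵢ, uⱼ` slots, then
`#E ≤ 1872 (K+1) · #Z`. -/
theorem card_le_of_foot_map_sep (A : EuclideanSpace ℝ (Fin 3) ≃ₗᵢ[ℝ] EuclideanSpace ℝ (Fin 3))
    (E Z : Finset (EuclideanSpace ℝ (Fin 3))) (hE1 : ∀ p ∈ E, ∀ q ∈ E, p ≠ q → 1 ≤ dist p q) (K : ℕ)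
    (hE : ∀ e ∈ E, ∃ z ∈ Z, ∃ uᵢ ∈ fccSlots, ∃ uⱼ ∈ fccSlots, ∃ k : ℕ, k ≤ K ∧
      (z = e + (k : ℝ) • A (uᵢ - uⱼ) ∨ dist (e + (k : ℝ) • A (uᵢ - uⱼ)) z = 1)) :
    E.card ≤ 1872 * (K + 1) * Z.card := by
  set F : EuclideanSpace ℝ (Fin 3) → Finset (EuclideanSpace ℝ (Fin 3)) := fun z =>
    (range (K + 1) ×ˢ (fccSlots ×ˢ fccSlots)).biUnion fun p =>
      E.filter fun e => z = e + (p.1 : ℝ) • A (p.2.1 - p.2.2) ∨ dist (e + (p.1 : ℝ) • A (p.2.1 - p.2.2)) z = 1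
    with hF
  have hsub : E ⊆ Z.biUnion F := by
    intro e he
    obtain ⟨z, hz, uᵢ, hi, uⱼ, hj, k, hk, hyz⟩ := hE e he
    rw [mem_biUnion]
    refine ⟨z, hz, ?_⟩
    rw [hF, mem_biUnion]
    refine ⟨(k, (uᵢ, uⱼ)), ?_, ?_⟩
    · rw [mem_product, mem_product, mem_range]
      exact ⟨Nat.lt_succ_of_le hk, hi, hj⟩
    · exact mem_filter.2 ⟨he, hyz⟩
  have hfib : ∀ z (c : EuclideanSpace ℝ (Fin 3)),
      (E.filter fun e => z = e + c ∨ dist (e + c) z = 1).card ≤ 13 := by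
    intro z c
    have hsub' : (E.filter fun e => z = e + c ∨ dist (e + c) z = 1) ⊆
        insert (z - c) (E.filter fun q => dist (z - c) q = 1) := by
      intro e he
      rw [mem_filter] at he
      rw [mem_insert]
      rcases he.2 with h | h
      · exact Or.inl (by rw [h, add_sub_cancel_right])
      · refine Or.inr (mem_filter.2 ⟨he.1, ?_⟩)
        rw [dist_eq_norm, show z - c - e = z - (e + c) by abel]
        rw [dist_comm, dist_eq_norm] at h
        exact h
    calc (E.filter fun e => z = e + c ∨ dist (e + c) z = 1).card
        ≤ (insert (z - c) (E.filter fun q => dist (z - c) q = 1)).card := card_le_card hsub'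
      _ ≤ (E.filter fun q => dist (z - c) q = 1).card + 1 := card_insert_le _ _
      _ ≤ 12 + 1 := by have := card_filter_dist_eq_one_le_twelve E hE1 (z - c); omega
      _ = 13 := by norm_num
  have hFcard : ∀ z, (F z).card ≤ 1872 * (K + 1) := by
    intro z
    rw [hF]
    refine card_biUnion_le.trans ?_
    calc ∑ p ∈ range (K + 1) ×ˢ (fccSlots ×ˢ fccSlots),
          (E.filter fun e => z = e + (p.1 : ℝ) • A (p.2.1 - p.2.2) ∨
            dist (e + (p.1 : ℝ) • A (p.2.1 - p.2.2)) z = 1).card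
        ≤ ∑ _p ∈ range (K + 1) ×ˢ (fccSlots ×ˢ fccSlots), 13 := sum_le_sum fun p _ => hfib z _
      _ = 1872 * (K + 1) := by
        rw [sum_const, smul_eq_mul, card_product, card_product, card_range, card_fccSlots]; ring
  calc E.card ≤ (Z.biUnion F).card := card_le_card hsub
    _ ≤ ∑ z ∈ Z, (F z).card := card_biUnion_le
    _ ≤ ∑ _z ∈ Z, 1872 * (K + 1) := sum_le_sum fun z _ => hFcard z
    _ = 1872 * (K + 1) * Z.card := by rw [sum_const, smul_eq_mul]; ring

/-- Numeric: if `√(2/3) ≤ S + s` and `s ≤ 2/5` then `1/3 ≤ (√3/2)·S`. -/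
theorem third_le_descent_rate {S s : ℝ} (h1 : Real.sqrt (2 / 3) ≤ S + s) (h2 : s ≤ 2 / 5) :
    1 / 3 ≤ Real.sqrt 3 / 2 * S := by
  have hsq2 : (1.41 : ℝ) ≤ Real.sqrt 2 := by
    have := Real.sqrt_le_sqrt (show ((1.41 : ℝ)) ^ 2 ≤ 2 by norm_num)
    rwa [Real.sqrt_sq (by norm_num)] at this
  have hsq3 : Real.sqrt 3 ≤ 1.7321 := by
    have := Real.sqrt_le_sqrt (show (3 : ℝ) ≤ (1.7321 : ℝ) ^ 2 by norm_num)
    rwa [Real.sqrt_sq (by norm_num)] at this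
  have hsq3' : 0 ≤ Real.sqrt 3 := Real.sqrt_nonneg 3
  have h32 : Real.sqrt 3 * Real.sqrt (2 / 3) = Real.sqrt 2 := by
    rw [← Real.sqrt_mul (by norm_num)]; norm_num
  have : Real.sqrt 3 * Real.sqrt (2 / 3) ≤ Real.sqrt 3 * (S + s) := mul_le_mul_of_nonneg_left h1 hsq3'
  rw [h32] at this
  nlinarith

end Summit.Ventures.Crystal3D.Theorems

end
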